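import Mathlib
import Summits.ValiantsHypothesis.ValiantsHypothesis.Theorems.NewtonUnitEquationsNewtonTauWeakCornerWords

/-!
# `NewtonTauWeak` (stmt-ValiantsHypothesis-5904), line `binomial-normal-form`: corner model — fibre sums and
# the core of the `K = 3` corner rigidity lemma

Second of three files (after `…CornerWords.lean`) formalising the `K = 3` CORNER RIGIDITY LEMMA of
`Cruxes/NewtonTauWeak/Lines/binomial-normal-form-ltc.md` §5 (lead c2).  Fibre sums of the corner combination
`κ₁ Π_e U_e(X^{E_e}) + κ₂ Π_e W_e(X^{E_e})` at a pure-power point below the mixed threshold (`fibreSum_pure`: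
only the pure word contributes) and at the lightest pair point (`fibreSum_pairPoint`), and the ASYMMETRIC CORE
`corner_core` (registered stub): with `e₁, e₂` the two `w`-lightest order directions of `U` and `W`'s mixed
words weighing at least `U`'s threshold `ω`, an off-ray `w`-initial point `v` of the corner model equals
`o₁E_{e₁} + o₂E_{e₂}` unless that point is on a ray.  Steps: `wt v ≥ ω`; the order points `o_iE_{e_i}` are
lighter than `v`, hence cancelled, which forces `κ₁u_i + κ₂w_i = 0`; every order point of `W` weighs at least
the corresponding one of `U` (else it is an uncancelled lighter point), so the weight bound applies to `W` with
the same two directions; the fibre sum at the pair point is `κ₁u₁u₂(κ₁+κ₂)/κ₂ ≠ 0`; minimality gives `v`.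

Main results: `corner_core`, `fibreSum_pure`, `fibreSum_pairPoint`.  No definitions. [new for this line]
-/

-- the namespace mandated for this Theorems file repeats the component `ValiantsHypothesis`
set_option linter.dupNamespace false

noncomputable section

open scoped BigOperators Polynomial

namespace Summit.ValiantsHypothesis.ValiantsHypothesis.Theorems.NewtonTauWeakCorner

/-! ## Fibre sums at pure-power points and at the lightest pair -/

/-- **Fibre sum at a pure power point below the mixed threshold.** If every word with at least two nonzero
letters that contributes to `κ₁U + κ₂W` weighs more than the on-ray point `z = k·E_e` (`1 ≤ k ≤ D`), then
the fibre sum at `z` is the pure coefficient `κ₁ [s^k]U_e + κ₂ [s^k]W_e`. [folklore] -/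
theorem fibreSum_pure {s D : ℕ} (E : Fin s → Fin 2 → ℤ) (w : Fin 2 → ℝ)
    (hw : ∀ e, 0 < wt w (E e))
    (hE : ∀ e e' : Fin s, ∀ k k' : ℕ, 1 ≤ k → (k : ℤ) • E e = (k' : ℤ) • E e' → e = e')
    (κ₁ κ₂ : ℂ) (U W : Fin s → ℂ[X]) (hU0 : ∀ e, (U e).coeff 0 = 1) (hW0 : ∀ e, (W e).coeff 0 = 1)
    (e : Fin s) (k : ℕ) (hk : 1 ≤ k) (hkD : k ≤ D)
    (hmixed : ∀ n ∈ box s D, 2 ≤ (Finset.univ.filter fun x => n x ≠ 0).card →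
      (sepCoeff U n ≠ 0 ∨ sepCoeff W n ≠ 0) → wt w ((k : ℤ) • E e) < wt w (push E n)) :
    fibreSum E D κ₁ κ₂ U W ((k : ℤ) • E e) = κ₁ * (U e).coeff k + κ₂ * (W e).coeff k := by
  classical
  unfold fibreSum
  rw [Finset.sum_eq_single_of_mem (Pi.single e k)]
  · rw [sepCoeff_single U hU0, sepCoeff_single W hW0]
  · exact Finset.mem_filter.mpr ⟨single_mem_box e hkD, push_single E e k⟩
  · intro n hn hne
    obtain ⟨hnbox, hpush⟩ := Finset.mem_filter.mp hn
    by_cases h2 : 2 ≤ (Finset.univ.filter fun x => n x ≠ 0).card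
    · have hU : sepCoeff U n = 0 := by
        by_contra hU
        have := hmixed n hnbox h2 (Or.inl hU)
        rw [hpush] at this
        exact lt_irrefl _ this
      have hW : sepCoeff W n = 0 := by
        by_contra hW
        have := hmixed n hnbox h2 (Or.inr hW)
        rw [hpush] at this
        exact lt_irrefl _ this
      rw [hU, hW]; ring
    · exfalso
      rcases eq_zero_or_single_of_card_le_one n (by omega) with h0 | ⟨e', k', hk', hn'⟩
      · subst h0
        rw [push_zero] at hpush
        have h1 : wt w ((k : ℤ) • E e) = 0 := by rw [← hpush, wt_zero]
        rw [wt_zsmul] at h1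
        have : (0 : ℝ) < (k : ℤ) * wt w (E e) := mul_pos (by exact_mod_cast hk) (hw e)
        linarith
      · subst hn'
        rw [push_single] at hpush
        have hee : e' = e := hE e' e k' k hk' hpush
        subst hee
        have hkk : k' = k := by
          have h1 := congrArg (wt w) hpush
          rw [wt_zsmul, wt_zsmul] at h1
          have := mul_right_cancel₀ (hw e').ne' h1
          exact_mod_cast this
        subst hkk
        exact hne rfl

/-- **Fibre sum at the lightest pair.** If the off-ray point `z = o₁E_{e₁} + o₂E_{e₂}` is reached, among
contributing words with at least two letters, only by the two-letter word itself (for `U` and for `W`),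
then the fibre sum there is `κ₁ u₁u₂ + κ₂ w₁w₂`. [folklore] -/
theorem fibreSum_pairPoint {s D : ℕ} (E : Fin s → Fin 2 → ℤ)
    (κ₁ κ₂ : ℂ) (U W : Fin s → ℂ[X]) (hU0 : ∀ e, (U e).coeff 0 = 1) (hW0 : ∀ e, (W e).coeff 0 = 1)
    {e₁ e₂ : Fin s} (hne : e₁ ≠ e₂) (o₁ o₂ : ℕ) (h1D : o₁ ≤ D) (h2D : o₂ ≤ D)
    (hz0 : push E (Pi.single e₁ o₁ + Pi.single e₂ o₂) ≠ 0)
    (hoff : ¬ OnRay E (push E (Pi.single e₁ o₁ + Pi.single e₂ o₂)))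
    (huniqU : ∀ n ∈ box s D, 2 ≤ (Finset.univ.filter fun x => n x ≠ 0).card → sepCoeff U n ≠ 0 →
      push E n = push E (Pi.single e₁ o₁ + Pi.single e₂ o₂) → n = Pi.single e₁ o₁ + Pi.single e₂ o₂)
    (huniqW : ∀ n ∈ box s D, 2 ≤ (Finset.univ.filter fun x => n x ≠ 0).card → sepCoeff W n ≠ 0 →
      push E n = push E (Pi.single e₁ o₁ + Pi.single e₂ o₂) → n = Pi.single e₁ o₁ + Pi.single e₂ o₂) :
    fibreSum E D κ₁ κ₂ U W (push E (Pi.single e₁ o₁ + Pi.single e₂ o₂))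
      = κ₁ * ((U e₁).coeff o₁ * (U e₂).coeff o₂) + κ₂ * ((W e₁).coeff o₁ * (W e₂).coeff o₂) := by
  classical
  unfold fibreSum
  rw [Finset.sum_eq_single_of_mem (Pi.single e₁ o₁ + Pi.single e₂ o₂)]
  · rw [sepCoeff_pair U hU0 hne, sepCoeff_pair W hW0 hne]
  · exact Finset.mem_filter.mpr ⟨pair_mem_box hne h1D h2D, rfl⟩
  · intro n hn hne'
    obtain ⟨hnbox, hpush⟩ := Finset.mem_filter.mp hn
    have h2 := two_le_card_of_offRay E hpush hz0 hoff
    have hU : sepCoeff U n = 0 := by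
      by_contra hU
      exact hne' (huniqU n hnbox h2 hU hpush)
    have hW : sepCoeff W n = 0 := by
      by_contra hW
      exact hne' (huniqW n hnbox h2 hW hpush)
    rw [hU, hW]; ring

/-! ## The core of the corner rigidity lemma (asymmetric form) -/

/-- **Core (asymmetric) corner lemma.** See `corner_rigidity` for the symmetric statement and the
meaning of the hypotheses; here `e₁, e₂` are the two `w`-lightest active directions of `U` (orders `o`),
and `W`'s mixed words are assumed to weigh at least `U`'s mixed threshold (`hWge`). [this line; new] -/
theorem corner_core {s D : ℕ} (E : Fin s → Fin 2 → ℤ) (w : Fin 2 → ℝ)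
    (hw : ∀ e, 0 < wt w (E e)) (hgen : Function.Injective (wt w))
    (hE : ∀ e e' : Fin s, ∀ k k' : ℕ, 1 ≤ k → (k : ℤ) • E e = (k' : ℤ) • E e' → e = e')
    (κ₁ κ₂ : ℂ) (hκ : κ₁ + κ₂ = 1) (hκ₁ : κ₁ ≠ 0) (hκ₂ : κ₂ ≠ 0)
    (U W : Fin s → ℂ[X]) (hU0 : ∀ e, (U e).coeff 0 = 1) (hW0 : ∀ e, (W e).coeff 0 = 1)
    (hUD : ∀ e, (U e).natDegree ≤ D) (hWD : ∀ e, (W e).natDegree ≤ D)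
    (o oW : Fin s → ℕ) (ho : ∀ e, Active (U e) → IsOrder (U e) (o e))
    (hoW : ∀ e, Active (W e) → IsOrder (W e) (oW e))
    (e₁ e₂ : Fin s) (hne : e₁ ≠ e₂) (h1 : Active (U e₁)) (h2 : Active (U e₂))
    (h1min : ∀ e, Active (U e) → (o e₁ : ℝ) * wt w (E e₁) ≤ (o e : ℝ) * wt w (E e))
    (h2min : ∀ e, e ≠ e₁ → Active (U e) → (o e₂ : ℝ) * wt w (E e₂) ≤ (o e : ℝ) * wt w (E e))
    (hWge : ∀ n ∈ box s D, 2 ≤ (Finset.univ.filter fun x => n x ≠ 0).card → sepCoeff W n ≠ 0 →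
      (o e₁ : ℝ) * wt w (E e₁) + (o e₂ : ℝ) * wt w (E e₂) ≤ wt w (push E n))
    (v : Fin 2 → ℤ) (hv0 : v ≠ 0) (hoff : ¬ OnRay E v) (hv : fibreSum E D κ₁ κ₂ U W v ≠ 0)
    (hcanc : ∀ z, z ≠ 0 → wt w z < wt w v → fibreSum E D κ₁ κ₂ U W z = 0) :
    v = (o e₁ : ℤ) • E e₁ + (o e₂ : ℤ) • E e₂ ∨ OnRay E ((o e₁ : ℤ) • E e₁ + (o e₂ : ℤ) • E e₂) := by
  classical
  -- notation
  set ω : ℝ := (o e₁ : ℝ) * wt w (E e₁) + (o e₂ : ℝ) * wt w (E e₂) with hω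
  have hGB := weight_ge_two_lightest E w hw hgen hE U o ho e₁ e₂ hne h2 h1min h2min
  have ho1 := ho e₁ h1
  have ho2 := ho e₂ h2
  have hval1pos : 0 < (o e₁ : ℝ) * wt w (E e₁) := mul_pos (by exact_mod_cast ho1.1) (hw e₁)
  have hval2pos : 0 < (o e₂ : ℝ) * wt w (E e₂) := mul_pos (by exact_mod_cast ho2.1) (hw e₂)
  have hwt1 : wt w ((o e₁ : ℤ) • E e₁) = (o e₁ : ℝ) * wt w (E e₁) := by rw [wt_zsmul]; push_cast; ring
  have hwt2 : wt w ((o e₂ : ℤ) • E e₂) = (o e₂ : ℝ) * wt w (E e₂) := by rw [wt_zsmul]; push_cast; ring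
  -- Step A: the weight of `v` is at least the mixed threshold `ω`
  have hA : ω ≤ wt w v := by
    unfold fibreSum at hv
    obtain ⟨n, hn, hsum⟩ := Finset.exists_ne_zero_of_sum_ne_zero hv
    obtain ⟨hnbox, hpush⟩ := Finset.mem_filter.mp hn
    have h2 := two_le_card_of_offRay E hpush hv0 hoff
    rw [← hpush]
    by_cases hU : sepCoeff U n = 0
    · have hW : sepCoeff W n ≠ 0 := by
        intro hW; apply hsum; rw [hU, hW]; ring
      exact hWge n hnbox h2 hW
    · exact (hGB n h2 hU).1
  -- mixed words are heavier than any point lighter than `ω`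
  have hmixed : ∀ z : Fin 2 → ℤ, wt w z < ω → ∀ n ∈ box s D,
      2 ≤ (Finset.univ.filter fun x => n x ≠ 0).card → (sepCoeff U n ≠ 0 ∨ sepCoeff W n ≠ 0) →
      wt w z < wt w (push E n) := by
    intro z hz n hnbox h2 hUW
    rcases hUW with hU | hW
    · exact lt_of_lt_of_le hz (hGB n h2 hU).1
    · exact lt_of_lt_of_le hz (hWge n hnbox h2 hW)
  -- Step C: cancellation at `r₁ = o₁ E_{e₁}` forces `κ₁ u₁ + κ₂ w₁ = 0`
  have hr1lt : wt w ((o e₁ : ℤ) • E e₁) < wt w v := by rw [hwt1]; linarith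
  have hr1ne : ((o e₁ : ℤ) • E e₁) ≠ 0 := by
    intro h; have := congrArg (wt w) h; rw [hwt1, wt_zero] at this; linarith
  have hC : κ₁ * (U e₁).coeff (o e₁) + κ₂ * (W e₁).coeff (o e₁) = 0 := by
    rw [← fibreSum_pure E w hw hE κ₁ κ₂ U W hU0 hW0 e₁ (o e₁) ho1.1 (ho1.le_natDegree.trans (hUD e₁))
      (hmixed _ (by rw [hwt1]; linarith))]
    exact hcanc _ hr1ne hr1lt
  -- Step D: the same at `r₂`
  have hr2lt : wt w ((o e₂ : ℤ) • E e₂) < wt w v := by rw [hwt2]; linarith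
  have hr2ne : ((o e₂ : ℤ) • E e₂) ≠ 0 := by
    intro h; have := congrArg (wt w) h; rw [hwt2, wt_zero] at this; linarith
  have hD' : κ₁ * (U e₂).coeff (o e₂) + κ₂ * (W e₂).coeff (o e₂) = 0 := by
    rw [← fibreSum_pure E w hw hE κ₁ κ₂ U W hU0 hW0 e₂ (o e₂) ho2.1 (ho2.le_natDegree.trans (hUD e₂))
      (hmixed _ (by rw [hwt2]; linarith))]
    exact hcanc _ hr2ne hr2lt
  have hu1 : (U e₁).coeff (o e₁) ≠ 0 := ho1.2.1
  have hu2 : (U e₂).coeff (o e₂) ≠ 0 := ho2.2.1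
  have hw1 : (W e₁).coeff (o e₁) = -(κ₁ / κ₂) * (U e₁).coeff (o e₁) := by
    field_simp; linear_combination hC
  have hw2 : (W e₂).coeff (o e₂) = -(κ₁ / κ₂) * (U e₂).coeff (o e₂) := by
    field_simp; linear_combination hD'
  have hw1ne : (W e₁).coeff (o e₁) ≠ 0 := by
    rw [hw1]; exact mul_ne_zero (neg_ne_zero.mpr (div_ne_zero hκ₁ hκ₂)) hu1
  have hw2ne : (W e₂).coeff (o e₂) ≠ 0 := by
    rw [hw2]; exact mul_ne_zero (neg_ne_zero.mpr (div_ne_zero hκ₁ hκ₂)) hu2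
  have hW1act : Active (W e₁) := ⟨o e₁, ho1.1, hw1ne⟩
  have hW2act : Active (W e₂) := ⟨o e₂, ho2.1, hw2ne⟩
  -- Step E: the order structure of `W` dominates that of `U`
  have hE1 : ∀ e, Active (W e) → (o e₁ : ℝ) * wt w (E e₁) ≤ (oW e : ℝ) * wt w (E e) := by
    intro e hAe
    by_contra hlt
    push Not at hlt
    have hoWe := hoW e hAe
    have hplt : wt w ((oW e : ℤ) • E e) < wt w v := by
      rw [wt_zsmul]; push_cast; linarith
    have hpne : ((oW e : ℤ) • E e) ≠ 0 := by
      intro h; have := congrArg (wt w) h; rw [wt_zsmul, wt_zero] at this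
      have : (0 : ℝ) < (oW e : ℤ) * wt w (E e) := mul_pos (by exact_mod_cast hoWe.1) (hw e)
      linarith
    have hfs := hcanc _ hpne hplt
    rw [fibreSum_pure E w hw hE κ₁ κ₂ U W hU0 hW0 e (oW e) hoWe.1 (hoWe.le_natDegree.trans (hWD e))
      (hmixed _ (by rw [wt_zsmul]; push_cast; linarith))] at hfs
    -- the `U`-coefficient at that order vanishes, by minimality of `e₁`
    have hUz : (U e).coeff (oW e) = 0 := by
      by_contra hUne
      have hAU : Active (U e) := ⟨oW e, hoWe.1, hUne⟩
      have hle : o e ≤ oW e := (ho e hAU).le_of_coeff_ne_zero hoWe.1 hUne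
      have := h1min e hAU
      have : (o e : ℝ) * wt w (E e) ≤ (oW e : ℝ) * wt w (E e) :=
        mul_le_mul_of_nonneg_right (by exact_mod_cast hle) (hw e).le
      linarith
    rw [hUz] at hfs
    have : κ₂ * (W e).coeff (oW e) ≠ 0 := mul_ne_zero hκ₂ hoWe.2.1
    apply this
    linear_combination hfs
  have hE2 : ∀ e, e ≠ e₁ → Active (W e) → (o e₂ : ℝ) * wt w (E e₂) ≤ (oW e : ℝ) * wt w (E e) := by
    intro e hee hAe
    by_contra hlt
    push Not at hlt
    have hoWe := hoW e hAe
    have hω' : (o e₂ : ℝ) * wt w (E e₂) < ω := by linarith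
    have hplt : wt w ((oW e : ℤ) • E e) < wt w v := by
      rw [wt_zsmul]; push_cast; linarith
    have hpne : ((oW e : ℤ) • E e) ≠ 0 := by
      intro h; have := congrArg (wt w) h; rw [wt_zsmul, wt_zero] at this
      have : (0 : ℝ) < (oW e : ℤ) * wt w (E e) := mul_pos (by exact_mod_cast hoWe.1) (hw e)
      linarith
    have hfs := hcanc _ hpne hplt
    rw [fibreSum_pure E w hw hE κ₁ κ₂ U W hU0 hW0 e (oW e) hoWe.1 (hoWe.le_natDegree.trans (hWD e))
      (hmixed _ (by rw [wt_zsmul]; push_cast; linarith))] at hfs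
    have hUz : (U e).coeff (oW e) = 0 := by
      by_contra hUne
      have hAU : Active (U e) := ⟨oW e, hoWe.1, hUne⟩
      have hle : o e ≤ oW e := (ho e hAU).le_of_coeff_ne_zero hoWe.1 hUne
      have := h2min e hee hAU
      have : (o e : ℝ) * wt w (E e) ≤ (oW e : ℝ) * wt w (E e) :=
        mul_le_mul_of_nonneg_right (by exact_mod_cast hle) (hw e).le
      linarith
    rw [hUz] at hfs
    have : κ₂ * (W e).coeff (oW e) ≠ 0 := mul_ne_zero hκ₂ hoWe.2.1
    apply this
    linear_combination hfs
  have hoW1 : oW e₁ = o e₁ := by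
    apply le_antisymm
    · exact (hoW e₁ hW1act).le_of_coeff_ne_zero ho1.1 hw1ne
    · have := hE1 e₁ hW1act
      have h := le_of_mul_le_mul_right this (hw e₁)
      exact_mod_cast h
  have hoW2 : oW e₂ = o e₂ := by
    apply le_antisymm
    · exact (hoW e₂ hW2act).le_of_coeff_ne_zero ho2.1 hw2ne
    · have := hE2 e₂ (Ne.symm hne) hW2act
      have h := le_of_mul_le_mul_right this (hw e₂)
      exact_mod_cast h
  -- Step F: the weight bound for `W` with the same two directions
  have hGBW := weight_ge_two_lightest E w hw hgen hE W oW hoW e₁ e₂ hne hW2act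
    (fun e hAe => by rw [hoW1]; exact hE1 e hAe) (fun e hee hAe => by rw [hoW2]; exact hE2 e hee hAe)
  -- Step G: the fibre sum at the pair point
  by_cases hray : OnRay E ((o e₁ : ℤ) • E e₁ + (o e₂ : ℤ) • E e₂)
  · exact Or.inr hray
  left
  have hpushq : push E (Pi.single e₁ (o e₁) + Pi.single e₂ (o e₂)) = (o e₁ : ℤ) • E e₁ + (o e₂ : ℤ) • E e₂ := by
    rw [push_add, push_single, push_single]
  have hwtq : wt w ((o e₁ : ℤ) • E e₁ + (o e₂ : ℤ) • E e₂) = ω := by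
    rw [wt_add, hwt1, hwt2]
  have hq0 : ((o e₁ : ℤ) • E e₁ + (o e₂ : ℤ) • E e₂) ≠ 0 := by
    intro h; have := congrArg (wt w) h; rw [hwtq, wt_zero] at this; linarith
  have hG : fibreSum E D κ₁ κ₂ U W ((o e₁ : ℤ) • E e₁ + (o e₂ : ℤ) • E e₂) ≠ 0 := by
    rw [← hpushq, fibreSum_pairPoint E κ₁ κ₂ U W hU0 hW0 hne (o e₁) (o e₂)
      (ho1.le_natDegree.trans (hUD e₁)) (ho2.le_natDegree.trans (hUD e₂))
      (by rw [hpushq]; exact hq0) (by rw [hpushq]; exact hray)]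
    · rw [hw1, hw2]
      have : κ₁ * ((U e₁).coeff (o e₁) * (U e₂).coeff (o e₂)) +
          κ₂ * (-(κ₁ / κ₂) * (U e₁).coeff (o e₁) * (-(κ₁ / κ₂) * (U e₂).coeff (o e₂)))
          = (κ₁ / κ₂) * (κ₁ + κ₂) * ((U e₁).coeff (o e₁) * (U e₂).coeff (o e₂)) := by
        field_simp; ring
      rw [this, hκ, mul_one]
      exact mul_ne_zero (div_ne_zero hκ₁ hκ₂) (mul_ne_zero hu1 hu2)
    · intro n hnbox h2 hU hpush
      rw [hpushq] at hpush
      have heq : (o e₁ : ℝ) * wt w (E e₁) + (o e₂ : ℝ) * wt w (E e₂) = wt w (push E n) := by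
        rw [hpush, hwtq]
      exact (hGB n h2 hU).2 heq
    · intro n hnbox h2 hW hpush
      rw [hpushq] at hpush
      have heq : (oW e₁ : ℝ) * wt w (E e₁) + (oW e₂ : ℝ) * wt w (E e₂) = wt w (push E n) := by
        rw [hpush, hwtq, hoW1, hoW2]
      have := (hGBW n h2 hW).2 heq
      rw [hoW1, hoW2] at this
      exact this
  -- Step H: `v` is the pair point
  have hnotlt : ¬ wt w ((o e₁ : ℤ) • E e₁ + (o e₂ : ℤ) • E e₂) < wt w v := fun hlt => hG (hcanc _ hq0 hlt)
  have heqw : wt w v = wt w ((o e₁ : ℤ) • E e₁ + (o e₂ : ℤ) • E e₂) := by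
    rw [hwtq]; push Not at hnotlt; rw [hwtq] at hnotlt; linarith
  exact hgen heqw

end Summit.ValiantsHypothesis.ValiantsHypothesis.Theorems.NewtonTauWeakCorner

end
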